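import Mathlib
import Summits.NavierStokesRegularity.NavierStokesRegularity.Theorems.OrthantWakeDyadicBreakBelowOneOfShellBarrier
import Summits.NavierStokesRegularity.NavierStokesRegularity.Theorems.SubOnsagerCeilingForwardTailCeilingKPDyadicLowRange
import HarnessLib

/-!
# `OrthantWake.DyadicBreakBelowOne` on `[9/16, 1]`: no Theorem-4.2 blow-up for the dyadic member
# at every shell ratio `1 + ε₀ ∈ [25/16, 2]`

Item stmt-NavierStokesRegularity-24644 (`OrthantWake.DyadicBreakBelowOne`, aside «open in print»:
`∀ ε₀ ∈ (0,1), ∀ X₀, ¬ NoGlobalCascade ε₀ dyadicTable X₀`, Barbato–Morandin–Romito's Theorem 1 for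
the Katz–Pavlović chain below shell ratio `2`).  This file (`--supports`) is the one-line consumer
of the route SubOnsagerCeiling's newest certified shell-barrier range

* `dyadicLowRangeWide_shellBarrierAt` (LEAD prover-ns-soc-p2, rung 4 under crux
  stmt-NavierStokesRegularity-27057: `ShellBarrierAt R ε₀ α`, `θ = 101/200 > 1/2`, `D = 100`,
  uniformly in `ν`, for every scaled dyadic table at every `ε₀ ∈ [9/16, 1]` — the second
  THREE-WINDOW region on `[25/16, 81/50]` (`dyadicLowRange_shellBarrierAt`, template cut
  `(429/1000)Yₙ − (957/1000)Y_{n+1} + Y_{n+2} ≤ 27/40`) glued at `31/50` with the landed range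
  `[31/50, 1]` (`dyadicWideRange_shellBarrierAt`))

through the interval-free adapter `dyadicBreakBelowOne_on_of_shellBarrierAt`
(`…DyadicBreakBelowOneOfShellBarrier.lean`: `w := θ`, `C := √(2·D·E₀)`, then the socket
`not_noGlobalCascade_dyadicTable_of_weightBound` = `forwardSourceSmoothing_proof` with `S = {0}` +
`orthantInvariance_proof` + `noGlobalCascade_iff_kappa`).

Result: `not_noGlobalCascade_dyadicTable_of_ge_nine_sixteenths` — for every `ε₀ ∈ [9/16, 1]` and
every one-shell datum, `¬ NoGlobalCascade ε₀ dyadicTable X₀`;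
`dyadicBreakBelowOne_of_ge_nine_sixteenths` is the item's shape on `[9/16, 1)`.  This supersedes
the range `[31/50, 1]` of `not_noGlobalCascade_dyadicTable_of_ge_thirtyone_fiftieths`; the part
`ε₀ < 9/16` of the item remains open (in print only `ε₀ = 1`, BMR 2011, Thm. 1).

HONEST FRAMING: theorems about a MODEL lattice ODE (route OrthantWake, rung TL-M2Break); nothing
here is a statement about the Navier–Stokes equations; the item (all of `(0,1)`) is not closed;
no crux, rung target or summit is proved.
[cite: BarbatoMorandinRomito2011, Thm. 1, §2 Lemma 2.1] [cite: Tao2016AveragedNS, §4 Thm. 4.2]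
-/

noncomputable section

set_option linter.dupNamespace false

namespace Summit.NavierStokesRegularity.NavierStokesRegularity.Theorems

open Set
open Literature.Analysis.FluidPDE.TaoCascade

/-- **`DyadicBreakBelowOne` on `[9/16, 1]`**: for every shell ratio `1+ε₀ ∈ [25/16, 2]` and every
one-shell datum `X₀`, Theorem 4.2-level blow-up fails for the dyadic member:
`¬ NoGlobalCascade ε₀ dyadicTable X₀` — the certified shell-barrier range
`dyadicLowRangeWide_shellBarrierAt` (`θ = 101/200 > 1/2`, uniformly in `ν`) through
`dyadicBreakBelowOne_on_of_shellBarrierAt`. MODEL lattice statement; `ε₀ < 9/16` remains open.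
[this file] -/
theorem not_noGlobalCascade_dyadicTable_of_ge_nine_sixteenths {ε₀ : ℝ} (h₁ : 9 / 16 ≤ ε₀)
    (h₂ : ε₀ ≤ 1) (X₀ : Fin 4 → ℝ) : ¬ NoGlobalCascade ε₀ dyadicTable X₀ :=
  dyadicBreakBelowOne_on_of_shellBarrierAt (by norm_num) dyadicLowRangeWide_shellBarrierAt ε₀ h₁ h₂ X₀

/-- The item's shape on the certified range: `∀ ε₀ ∈ [9/16, 1), ∀ X₀, ¬ NoGlobalCascade ε₀
dyadicTable X₀`. MODEL lattice statement. [this file] -/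
theorem dyadicBreakBelowOne_of_ge_nine_sixteenths :
    ∀ ε₀ : ℝ, 9 / 16 ≤ ε₀ → ε₀ < 1 → ∀ X₀ : Fin 4 → ℝ, ¬ NoGlobalCascade ε₀ dyadicTable X₀ :=
  fun _ h₁ h₂ X₀ => not_noGlobalCascade_dyadicTable_of_ge_nine_sixteenths h₁ h₂.le X₀

end Summit.NavierStokesRegularity.NavierStokesRegularity.Theorems

end
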